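import Mathlib
import Summits.ValiantsHypothesis.ValiantsHypothesis.Theorems.NewtonUnitEquationsNewtonTauWeakSumsetChartCount
import Summits.ValiantsHypothesis.ValiantsHypothesis.Theorems.NewtonUnitEquationsNewtonTauWeakFourCoreSplitting

/-!
# `NewtonUnitEquationsNewtonTauWeakFourCoreChartRel` — relative four-core bound in chart language

Line `binomial-normal-form` of crux `NewtonTauWeak` (stmt-ValiantsHypothesis-5904), lead c7, stub P10: the
MINKOWSKI SPLITTING THEOREM at `c = 4 = 2 + 2`, read THROUGH a sub-universe `V ⊆ Fin x`.  A four-core DESIGN is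
`h : Fin 4 → Finset (Fin x) → ℕ²`; a configuration `f : Fin x → Fin 4` has the `V`-relative point
`P_V f = Σ_d h d (V ∩ f⁻¹ d)` (elements outside `V` are ignored), and the stub bounds the number of LOWER-HULL VERTICES
of the cloud `C = {P_V f}` — the `σ = −1` chart points, i.e. the strict maximisers over `C` of a height `t·q₀ − q₁`,
`t ∈ ℝ` — by `2·3^{|V|} − 2^{|V|}`, in the subtraction-free shape `|U(C)| + 2^{|V|} ≤ 2·3^{|V|}`.

Proof (the model is the absolute case `stub_fourCoreSplitting`, `V = univ`).  Condition on the slice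
`W = V ∩ f⁻¹{2,3} ⊆ V`.  The `V`-relative points of the configurations with slice `W` form the planar sumset
`A_W ⊕ B_W` of `A_W = {h 0 ((V \ W) \ S) + h 1 S : S ⊆ V \ W}` and `B_W = {h 2 (W \ S') + h 3 S' : S' ⊆ W}`
(`sum_fibre_eq` slices, `sum_glue` glues back, so `A_W ⊕ B_W ⊆ C`).  A chart point of `C` lying in the slice `W` is a
chart point of `A_W ⊕ B_W` for the same `t`; by the chart lemma for planar Minkowski sums (the landed brick
`stub_sumsetChartCount`, through `FourCoreSplittingAux.chart_ncard_sumset_lt`) the slice has at most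
`|A_W| + |B_W| − 1 ≤ 2^{|V|−|W|} + 2^{|W|} − 1` chart points, and `Σ_{W ⊆ V} 2^{|W|} = Σ_{W ⊆ V} 2^{|V|−|W|} = 3^{|V|}`
(binomial theorem), `Σ_{W ⊆ V} 1 = 2^{|V|}`.  Everything is kept in `ℕ` in the shape `· + 1 ≤ ·`.

`stub_fourCoreChartRel` is the registered stub text, verbatim.  Folklore-level; Mathlib, the landed brick
`stub_sumsetChartCount` and the landed helpers `FourCoreSplittingAux.*` only; no citations, no `def`s.
-/

-- Sub = Summit single-conjunct layout: the duplicated namespace component is mandated by the tree.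
set_option linter.dupNamespace false

open scoped BigOperators

namespace Summit.ValiantsHypothesis.ValiantsHypothesis.Theorems.NewtonUnitEquationsNewtonTauWeak

namespace FourCoreChartRelAux

/-- RELATIVE GLUING: for `W ⊆ V`, `S ⊆ V \ W` (core `1`), `S' ⊆ W` (core `3`), the glued configuration has the
`V`-relative fibres `(V \ W) \ S, S, W \ S', S'`, hence the `V`-relative point
`(h 0 ((V \ W) \ S) + h 1 S) + (h 2 (W \ S') + h 3 S')`. [folklore] -/
theorem sum_glue {x : ℕ} (h : Fin 4 → Finset (Fin x) → (Fin 2 →₀ ℕ)) (V W S S' : Finset (Fin x)) (hW : W ⊆ V)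
    (hS : S ⊆ V \ W) (hS' : S' ⊆ W) (g : Fin x → Fin 4)
    (hg : ∀ u, g u = if u ∈ W then (if u ∈ S' then 3 else 2) else (if u ∈ S then 1 else 0)) :
    ∑ d, h d (V ∩ Finset.univ.filter fun u => g u = d) =
      (h 0 ((V \ W) \ S) + h 1 S) + (h 2 (W \ S') + h 3 S') := by
  have hSV : ∀ u, u ∈ S → u ∈ V ∧ u ∉ W := fun u hu => Finset.mem_sdiff.mp (hS hu)
  have hS'W : ∀ u, u ∈ S' → u ∈ W := fun u hu => hS' hu
  have hWV : ∀ u, u ∈ W → u ∈ V := fun u hu => hW hu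
  obtain ⟨h0, h1, h2, h3⟩ : (V ∩ Finset.univ.filter fun u => g u = 0) = (V \ W) \ S ∧
      (V ∩ Finset.univ.filter fun u => g u = 1) = S ∧ (V ∩ Finset.univ.filter fun u => g u = 2) = W \ S' ∧
      (V ∩ Finset.univ.filter fun u => g u = 3) = S' := by
    refine ⟨?_, ?_, ?_, ?_⟩ <;> ext u <;>
      simp only [Finset.mem_inter, Finset.mem_filter, Finset.mem_univ, true_and, Finset.mem_sdiff, hg u] <;>
      specialize hSV u <;> specialize hS'W u <;> specialize hWV u <;>
      by_cases hv : u ∈ V <;> by_cases hu : u ∈ W <;> by_cases hu1 : u ∈ S <;> by_cases hu3 : u ∈ S' <;> simp_all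
  rw [Fin.sum_univ_four, h0, h1, h2, h3, add_assoc]

/-- RELATIVE SLICING: along `W = V ∩ f⁻¹{2,3}` the `V`-relative point of `f` is the sum of an `A_W`-summand (coded by
`S = V ∩ f⁻¹ 1`) and a `B_W`-summand (coded by `S' = V ∩ f⁻¹ 3`). [folklore] -/
theorem sum_fibre_eq {x : ℕ} (h : Fin 4 → Finset (Fin x) → (Fin 2 →₀ ℕ)) (f : Fin x → Fin 4) (V W : Finset (Fin x))
    (hW : W = V ∩ Finset.univ.filter fun u => f u = 2 ∨ f u = 3) :
    ∑ d, h d (V ∩ Finset.univ.filter fun u => f u = d) =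
      (h 0 ((V \ W) \ (V ∩ Finset.univ.filter fun u => f u = 1)) + h 1 (V ∩ Finset.univ.filter fun u => f u = 1)) +
        (h 2 (W \ (V ∩ Finset.univ.filter fun u => f u = 3)) + h 3 (V ∩ Finset.univ.filter fun u => f u = 3)) := by
  have key0 : ∀ a : Fin 4, ¬(a = 2 ∨ a = 3) ∧ ¬a = 1 ↔ a = 0 := by decide
  have key2 : ∀ a : Fin 4, (a = 2 ∨ a = 3) ∧ ¬a = 3 ↔ a = 2 := by decide
  have h0 : (V \ W) \ (V ∩ Finset.univ.filter fun u => f u = 1) = V ∩ Finset.univ.filter fun u => f u = 0 := by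
    ext u
    simp only [hW, Finset.mem_sdiff, Finset.mem_inter, Finset.mem_filter, Finset.mem_univ, true_and]
    specialize key0 (f u)
    by_cases hv : u ∈ V <;> simp_all
  have h2 : W \ (V ∩ Finset.univ.filter fun u => f u = 3) = V ∩ Finset.univ.filter fun u => f u = 2 := by
    ext u
    simp only [hW, Finset.mem_sdiff, Finset.mem_inter, Finset.mem_filter, Finset.mem_univ, true_and]
    specialize key2 (f u)
    by_cases hv : u ∈ V <;> simp_all
  rw [Fin.sum_univ_four, h0, h2, add_assoc]

/-- `V ∩ f⁻¹ 1 ⊆ V \ W` for `W = V ∩ f⁻¹{2,3}`. [folklore] -/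
theorem filter_one_subset {x : ℕ} (f : Fin x → Fin 4) (V W : Finset (Fin x))
    (hW : W = V ∩ Finset.univ.filter fun u => f u = 2 ∨ f u = 3) :
    (V ∩ Finset.univ.filter fun u => f u = 1) ⊆ V \ W := by
  intro u hu
  rw [Finset.mem_inter, Finset.mem_filter] at hu
  rw [hW, Finset.mem_sdiff, Finset.mem_inter, Finset.mem_filter]
  refine ⟨hu.1, fun h23 => ?_⟩
  rcases h23.2.2 with h2 | h3
  · exact absurd (hu.2.2.symm.trans h2) (by decide)
  · exact absurd (hu.2.2.symm.trans h3) (by decide)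

/-- `V ∩ f⁻¹ 3 ⊆ W` for `W = V ∩ f⁻¹{2,3}`. [folklore] -/
theorem filter_three_subset {x : ℕ} (f : Fin x → Fin 4) (V W : Finset (Fin x))
    (hW : W = V ∩ Finset.univ.filter fun u => f u = 2 ∨ f u = 3) :
    (V ∩ Finset.univ.filter fun u => f u = 3) ⊆ W := by
  intro u hu
  rw [Finset.mem_inter, Finset.mem_filter] at hu
  rw [hW, Finset.mem_inter, Finset.mem_filter]
  exact ⟨hu.1, hu.2.1, Or.inr hu.2.2⟩

/-- RELATIVE SLICE MEMBERSHIP: the `V`-relative point of `f` lies in the sumset `A_W ⊕ B_W` of its own slice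
`W = V ∩ f⁻¹{2,3}`. [folklore] -/
theorem sum_fibre_mem {x : ℕ} (h : Fin 4 → Finset (Fin x) → (Fin 2 →₀ ℕ)) (f : Fin x → Fin 4) (V W : Finset (Fin x))
    (hW : W = V ∩ Finset.univ.filter fun u => f u = 2 ∨ f u = 3) (A B : Finset (Fin 2 →₀ ℕ))
    (hA : A = (V \ W).powerset.image fun S => h 0 ((V \ W) \ S) + h 1 S)
    (hB : B = W.powerset.image fun S => h 2 (W \ S) + h 3 S) :
    ∑ d, h d (V ∩ Finset.univ.filter fun u => f u = d) ∈
      (A ×ˢ B).image (fun pq : (Fin 2 →₀ ℕ) × (Fin 2 →₀ ℕ) => pq.1 + pq.2) := by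
  rw [sum_fibre_eq h f V W hW, hA, hB]
  exact SumsetChartCountAux.add_mem_sumset
    (Finset.mem_image_of_mem _ (Finset.mem_powerset.mpr (filter_one_subset f V W hW)))
    (Finset.mem_image_of_mem _ (Finset.mem_powerset.mpr (filter_three_subset f V W hW)))

/-- RELATIVE GLUING BACK: for `W ⊆ V` every point of the sumset `A_W ⊕ B_W` is the `V`-relative point of a
configuration. [folklore] -/
theorem exists_conf_of_mem {x : ℕ} (h : Fin 4 → Finset (Fin x) → (Fin 2 →₀ ℕ)) (V W : Finset (Fin x)) (hWV : W ⊆ V)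
    (A B : Finset (Fin 2 →₀ ℕ)) (hA : A = (V \ W).powerset.image fun S => h 0 ((V \ W) \ S) + h 1 S)
    (hB : B = W.powerset.image fun S => h 2 (W \ S) + h 3 S) (p : Fin 2 →₀ ℕ)
    (hp : p ∈ (A ×ˢ B).image (fun pq : (Fin 2 →₀ ℕ) × (Fin 2 →₀ ℕ) => pq.1 + pq.2)) :
    ∃ g : Fin x → Fin 4, ∑ d, h d (V ∩ Finset.univ.filter fun u => g u = d) = p := by
  subst hA hB
  obtain ⟨a, ha, b, hb, rfl⟩ := SumsetChartCountAux.mem_sumset_iff.mp hp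
  obtain ⟨S, hS, rfl⟩ := Finset.mem_image.mp ha
  obtain ⟨S', hS', rfl⟩ := Finset.mem_image.mp hb
  exact ⟨fun u => if u ∈ W then (if u ∈ S' then 3 else 2) else (if u ∈ S then 1 else 0),
    sum_glue h V W S S' hWV (Finset.mem_powerset.mp hS) (Finset.mem_powerset.mp hS') _ fun _ => rfl⟩

/-- `Σ_{W ⊆ V} 2^{|W|} = 3^{|V|}` (binomial theorem). [folklore] -/
theorem sum_two_pow_card {x : ℕ} (V : Finset (Fin x)) : ∑ W ∈ V.powerset, (2 : ℕ) ^ W.card = 3 ^ V.card := by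
  simpa using Finset.sum_pow_mul_eq_add_pow (2 : ℕ) 1 V

/-- `Σ_{W ⊆ V} 2^{|V| − |W|} = 3^{|V|}` (binomial theorem). [folklore] -/
theorem sum_two_pow_sub_card {x : ℕ} (V : Finset (Fin x)) :
    ∑ W ∈ V.powerset, (2 : ℕ) ^ (V.card - W.card) = 3 ^ V.card := by
  simpa [add_comm] using Finset.sum_pow_mul_eq_add_pow (1 : ℕ) 2 V

/-- `Σ_{W ⊆ V} 1 = 2^{|V|}`. [folklore] -/
theorem sum_one_eq {x : ℕ} (V : Finset (Fin x)) : ∑ _W ∈ V.powerset, (1 : ℕ) = 2 ^ V.card := by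
  simp [Finset.card_powerset]

end FourCoreChartRelAux

open FourCoreChartRelAux

/-- **STUB P10 `stub_fourCoreChartRel`** (registered signature, verbatim) — the relative four-core bound in chart
language: for `V ⊆ Fin x` and a four-core design read through `V` (`P_V f := Σ_d h d (V ∩ f⁻¹ d)`), the lower-hull
vertices (`σ = −1` chart points) of the cloud `im P_V` number at most `2·3^{|V|} − 2^{|V|}`.  Minkowski splitting
along `W = V ∩ f⁻¹{2,3}` and the chart lemma for planar sumsets. [folklore] -/
theorem stub_fourCoreChartRel (x : ℕ) (V : Finset (Fin x)) (h : Fin 4 → Finset (Fin x) → (Fin 2 →₀ ℕ)) :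
    {p : Fin 2 →₀ ℕ | p ∈ (Finset.univ.image fun f : Fin x → Fin 4 =>
          ∑ d, h d (V ∩ Finset.univ.filter fun u => f u = d)) ∧
        ∃ t : ℝ, ∀ q ∈ (Finset.univ.image fun f : Fin x → Fin 4 =>
          ∑ d, h d (V ∩ Finset.univ.filter fun u => f u = d)), q ≠ p →
          t * ((q 0 : ℕ) : ℝ) + (-1) * ((q 1 : ℕ) : ℝ) < t * ((p 0 : ℕ) : ℝ) + (-1) * ((p 1 : ℕ) : ℝ)}.ncard +
        2 ^ V.card ≤ 2 * 3 ^ V.card := by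
  -- the two factor clouds `A_W`, `B_W` and the chart set `U_W` of the slice `W ⊆ V`
  obtain ⟨A, hA⟩ : ∃ A : Finset (Fin x) → Finset (Fin 2 →₀ ℕ),
      ∀ W, A W = (V \ W).powerset.image fun S => h 0 ((V \ W) \ S) + h 1 S := ⟨_, fun _ => rfl⟩
  obtain ⟨B, hB⟩ : ∃ B : Finset (Fin x) → Finset (Fin 2 →₀ ℕ),
      ∀ W, B W = W.powerset.image fun S => h 2 (W \ S) + h 3 S := ⟨_, fun _ => rfl⟩
  obtain ⟨U, hU⟩ : ∃ U : Finset (Fin x) → Set (Fin 2 →₀ ℕ), ∀ W, U W =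
      {p : Fin 2 →₀ ℕ | p ∈ (A W ×ˢ B W).image (fun pq : (Fin 2 →₀ ℕ) × (Fin 2 →₀ ℕ) => pq.1 + pq.2) ∧
        ∃ t : ℝ, ∀ q ∈ (A W ×ˢ B W).image (fun pq : (Fin 2 →₀ ℕ) × (Fin 2 →₀ ℕ) => pq.1 + pq.2), q ≠ p →
          t * ((q 0 : ℕ) : ℝ) + (-1) * ((q 1 : ℕ) : ℝ) < t * ((p 0 : ℕ) : ℝ) + (-1) * ((p 1 : ℕ) : ℝ)} :=
    ⟨_, fun _ => rfl⟩
  -- per-slice bound `|U_W| + 1 ≤ |A_W| + |B_W| ≤ 2^{|V|−|W|} + 2^{|W|}` for `W ⊆ V`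
  have hslice : ∀ W ∈ V.powerset, (U W).ncard + 1 ≤ 2 ^ (V.card - W.card) + 2 ^ W.card := by
    intro W hW
    have hWV : W ⊆ V := Finset.mem_powerset.mp hW
    have hAne : (A W).Nonempty := by rw [hA]; exact (Finset.powerset_nonempty _).image _
    have hBne : (B W).Nonempty := by rw [hB]; exact (Finset.powerset_nonempty _).image _
    rw [hU]
    refine (FourCoreSplittingAux.chart_ncard_sumset_lt (A W) (B W) hAne hBne).trans (add_le_add ?_ ?_)
    · rw [hA]
      refine Finset.card_image_le.trans ?_
      rw [Finset.card_powerset, Finset.card_sdiff_of_subset hWV]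
    · rw [hB]
      refine Finset.card_image_le.trans ?_
      rw [Finset.card_powerset]
  -- each chart set is finite
  have hfin : ∀ W, (U W).Finite := fun W => by
    rw [hU]
    exact (Finset.finite_toSet _).subset fun p hp => hp.1
  -- counting over the `2^{|V|}` slices `W ⊆ V`
  have key : ∀ E : Set (Fin 2 →₀ ℕ), E ⊆ ⋃ W ∈ V.powerset, U W → E.ncard + 2 ^ V.card ≤ 2 * 3 ^ V.card := by
    intro E hE
    have h1 : E.ncard ≤ ∑ W ∈ V.powerset, (U W).ncard :=
      (Set.ncard_le_ncard hE ((Finset.finite_toSet _).biUnion fun W _ => hfin W)).trans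
        (Finset.set_ncard_biUnion_le _ _)
    have h2 : ∑ W ∈ V.powerset, ((U W).ncard + 1) ≤ ∑ W ∈ V.powerset, (2 ^ (V.card - W.card) + 2 ^ W.card) :=
      Finset.sum_le_sum hslice
    rw [Finset.sum_add_distrib, Finset.sum_add_distrib, sum_two_pow_sub_card, sum_two_pow_card, sum_one_eq] at h2
    omega
  refine key _ ?_
  -- a chart point of the whole cloud is a chart point (same `t`) of its own slice `W = V ∩ f⁻¹{2,3} ⊆ V`
  rintro p ⟨hp, t, ht⟩
  obtain ⟨f, -, rfl⟩ := Finset.mem_image.mp hp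
  have hWV : (V ∩ Finset.univ.filter fun u => f u = 2 ∨ f u = 3) ⊆ V := Finset.inter_subset_left
  refine Set.mem_iUnion₂_of_mem (Finset.mem_powerset.mpr hWV) ?_
  rw [hU, Set.mem_setOf_eq]
  refine ⟨sum_fibre_mem h f V _ rfl (A _) (B _) (hA _) (hB _), t, fun q hq hne => ?_⟩
  obtain ⟨g, hg⟩ := exists_conf_of_mem h V _ hWV (A _) (B _) (hA _) (hB _) q hq
  exact ht q (Finset.mem_image.mpr ⟨g, Finset.mem_univ _, hg⟩) hne

end Summit.ValiantsHypothesis.ValiantsHypothesis.Theorems.NewtonUnitEquationsNewtonTauWeak
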